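import Summits.CriticalPhenomena.PercolationContinuityZ3.Theorems.PercNearOneGluingNoHeavyLowerTailStarSetMixedCertificate
import Summits.CriticalPhenomena.PercolationContinuityZ3.Theorems.PercNearOneGluingNoHeavyLowerTailStarSetPairRowComonotone
import HarnessLib

/-!
# `NoHeavyLowerTail` (stmt-CriticalPhenomena-4575) — the MIXED (forest + chords) certificate, integrated (level `j ≤ 2`)

Support file (prover `prim-gen-swap` gen 9; `--supports stmt-CriticalPhenomena-4575`).  No definitions, no named facts, no sorries.

Integrates `StarSet.mixed_certificate_pointwise` (…StarSetMixedCertificate) against the product measure and discharges the rows: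
champion rows `Σ_S W(S)[μ(c light in ξ ∪ L_S) − μ(P_I light in ξ ∪ L_S)] = μ(c light) − μ(P_I light) ≥ 0`
(`StarSet.lightness_eq_linkSum` + domination), pair rows by the lonelier-member inequality in the link-glued graphs
(`StarSet.linkRow_le`), both pushed forward to class patterns by `StarSet.linkSum_pushforward`.

* `StarSet.mixed_comonotone_budget` — for a two-port star multigraph whose classes `Fin (Mf + Mc)` consist of a class forest in
  leaf-peeling order (first `Mf`) and arbitrary further classes (last `Mc`), `c ∈ A` off the ports dominating the class ports `P κ`,
  `C0 ≥ 0`, budget coefficients `b_t ≥ 0` with designated port sets `R_t`, and the supplies `hU0`, `hU1` of seat memo MWF-CERT.md §3: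
  `0 ≤ C0 · Σ_S W(S)·[μ(c ↮_ξ P_S, |π_ξ(c)| ≤ j) − μ(c ↮_ξ P_S, 1 ≤ |π_ξ(P_S)| ≤ j)] + Σ_t b_t · Σ_S W(S)·μ(c ↮_ξ R_t ∪ P_S, |π_ξ(c)| ≤ j)`.
With `Mf = 0` this is `StarSet.pairRow_comonotone_budget`; with `Mc = 0` and `b = 0` it is the class-forest theorem.
-/

noncomputable section

namespace Summit.CriticalPhenomena.PercolationContinuityZ3.Theorems

open MeasureTheory Set Literature.Probability.LatticeModels Literature.Probability.Percolation
open scoped Classical BigOperators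

variable {n Mf Mc : ℕ}

namespace StarSet

/-- **The mixed (forest + chords) certificate, integrated.**  See the file header.
[cite: VandenbergHaggstromKahn2005, Thm. 1.5 (p. 7) — only through the domination hypothesis `hdom`; seat memo MWF-CERT.md §3–§4] -/
theorem mixed_comonotone_budget {ι : Type*} [Fintype ι] (w : Sym2 (Fin n) → unitInterval) (A : Finset (Fin n)) {m : ℕ}
    (s p p' : Fin m → Fin n) (cls : Fin m → Fin (Mf + Mc)) (P P' : Fin (Mf + Mc) → Fin n)
    (hP : ∀ i, p i = P (cls i)) (hP' : ∀ i, p' i = P' (cls i))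
    (c : Fin n) (j : ℕ) (hj : j ≤ 2) (hs : Function.Injective s) (hsA : ∀ i, s i ∉ A)
    (hPA : ∀ κ, P κ ∈ A) (hP'A : ∀ κ, P' κ ∈ A) (hPP' : ∀ κ, P κ ≠ P' κ)
    (hnopar : ∀ I K : Fin (Mf + Mc), I ≠ K → ¬ ((P K = P I ∨ P K = P' I) ∧ (P' K = P I ∨ P' K = P' I)))
    (hforest : ∀ K I : Fin Mf, K < I → P' (Fin.castAdd Mc K) ≠ P (Fin.castAdd Mc I) ∧ P' (Fin.castAdd Mc K) ≠ P' (Fin.castAdd Mc I))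
    (hcA : c ∈ A) (hcP : ∀ κ, c ≠ P κ ∧ c ≠ P' κ)
    (hwjunk : ∀ i u, u ≠ s i → u ≠ p i → u ≠ p' i → w s(s i, u) = 0)
    (hdom : ∀ κ, (prodBernoulli w).real {ω : BondConfig (Fin n) | (A.filter fun z => ω ∈ openConn (P κ) z).card ≤ j} ≤
      (prodBernoulli w).real {ω : BondConfig (Fin n) | (A.filter fun z => ω ∈ openConn c z).card ≤ j})
    (C0 : ℝ) (hC0 : 0 ≤ C0) (b : ι → ℝ) (hb : ∀ t, 0 ≤ b t) (R : ι → Finset (Fin n))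
    (hRport : ∀ t, ∀ u ∈ R t, ∃ κ, u = P κ ∨ u = P' κ)
    (hU0 : C0 * (∑ I : Fin Mf, ((1 - ∏ i ∈ Finset.univ.filter (fun i => cls i = Fin.castAdd Mc I), (1 - (w s(s i, p i) : ℝ) * w s(s i, p' i))) *
          ∏ K ∈ Finset.univ.filter (· < I), ∏ i ∈ Finset.univ.filter (fun i => cls i = Fin.castAdd Mc K), (1 - (w s(s i, p i) : ℝ) * w s(s i, p' i))) +
        ∑ K : Fin Mc, ((1 - ∏ i ∈ Finset.univ.filter (fun i => cls i = Fin.natAdd Mf K), (1 - (w s(s i, p i) : ℝ) * w s(s i, p' i))) *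
          ∏ κ' ∈ Finset.univ.filter (fun κ' => ¬ (P κ' = P (Fin.natAdd Mf K) ∨ P κ' = P' (Fin.natAdd Mf K) ∨
              P' κ' = P (Fin.natAdd Mf K) ∨ P' κ' = P' (Fin.natAdd Mf K))),
            ∏ i ∈ Finset.univ.filter (fun i => cls i = κ'), (1 - (w s(s i, p i) : ℝ) * w s(s i, p' i)))) ≤ C0 + ∑ t, b t)
    (hU1 : ∀ r, C0 * (∑ I ∈ (Finset.univ : Finset (Fin Mf)).filter (fun I => P (Fin.castAdd Mc I) ≠ r), ((1 - ∏ i ∈ Finset.univ.filter (fun i => cls i = Fin.castAdd Mc I), (1 - (w s(s i, p i) : ℝ) * w s(s i, p' i))) *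
          ∏ K ∈ Finset.univ.filter (· < I), ∏ i ∈ Finset.univ.filter (fun i => cls i = Fin.castAdd Mc K), (1 - (w s(s i, p i) : ℝ) * w s(s i, p' i))) +
        ∑ K ∈ (Finset.univ : Finset (Fin Mc)).filter (fun K => P (Fin.natAdd Mf K) ≠ r ∧ P' (Fin.natAdd Mf K) ≠ r), ((1 - ∏ i ∈ Finset.univ.filter (fun i => cls i = Fin.natAdd Mf K), (1 - (w s(s i, p i) : ℝ) * w s(s i, p' i))) *
          ∏ κ' ∈ Finset.univ.filter (fun κ' => ¬ (P κ' = P (Fin.natAdd Mf K) ∨ P κ' = P' (Fin.natAdd Mf K) ∨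
              P' κ' = P (Fin.natAdd Mf K) ∨ P' κ' = P' (Fin.natAdd Mf K))),
            ∏ i ∈ Finset.univ.filter (fun i => cls i = κ'), (1 - (w s(s i, p i) : ℝ) * w s(s i, p' i)))) ≤
        C0 + ∑ t ∈ Finset.univ.filter (fun t => r ∉ R t), b t) :
    0 ≤ C0 * ∑ S ∈ (Finset.univ : Finset (Fin (Mf + Mc))).powerset, ((∏ κ ∈ S, (1 - ∏ i ∈ Finset.univ.filter (fun i => cls i = κ), (1 - (w s(s i, p i) : ℝ) * w s(s i, p' i)))) *
          ∏ κ ∈ Finset.univ \ S, ∏ i ∈ Finset.univ.filter (fun i => cls i = κ), (1 - (w s(s i, p i) : ℝ) * w s(s i, p' i))) *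
        ((prodBernoulli w).real {ω : BondConfig (Fin n) |
            (∀ u ∈ S.image P ∪ S.image P', ¬ (openGraph (ω ∩ {e | ∀ v ∈ Finset.univ.image s, v ∉ e})).Reachable c u) ∧
            (A.filter fun z => (openGraph (ω ∩ {e | ∀ v ∈ Finset.univ.image s, v ∉ e})).Reachable c z).card ≤ j} -
          (prodBernoulli w).real {ω : BondConfig (Fin n) |
            (∀ u ∈ S.image P ∪ S.image P', ¬ (openGraph (ω ∩ {e | ∀ v ∈ Finset.univ.image s, v ∉ e})).Reachable c u) ∧
            1 ≤ (A.filter fun z => ∃ u ∈ S.image P ∪ S.image P',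
              (openGraph (ω ∩ {e | ∀ v ∈ Finset.univ.image s, v ∉ e})).Reachable u z).card ∧
            (A.filter fun z => ∃ u ∈ S.image P ∪ S.image P',
              (openGraph (ω ∩ {e | ∀ v ∈ Finset.univ.image s, v ∉ e})).Reachable u z).card ≤ j}) +
      ∑ t, b t * ∑ S ∈ (Finset.univ : Finset (Fin (Mf + Mc))).powerset, ((∏ κ ∈ S, (1 - ∏ i ∈ Finset.univ.filter (fun i => cls i = κ), (1 - (w s(s i, p i) : ℝ) * w s(s i, p' i)))) *
          ∏ κ ∈ Finset.univ \ S, ∏ i ∈ Finset.univ.filter (fun i => cls i = κ), (1 - (w s(s i, p i) : ℝ) * w s(s i, p' i))) *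
        (prodBernoulli w).real {ω : BondConfig (Fin n) |
            (∀ u ∈ R t ∪ (S.image P ∪ S.image P'), ¬ (openGraph (ω ∩ {e | ∀ v ∈ Finset.univ.image s, v ∉ e})).Reachable c u) ∧
            (A.filter fun z => (openGraph (ω ∩ {e | ∀ v ∈ Finset.univ.image s, v ∉ e})).Reachable c z).card ≤ j} := by
  -- star-level facts
  have hpA : ∀ i, p i ∈ A := fun i => (hP i) ▸ hPA (cls i)
  have hp'A : ∀ i, p' i ∈ A := fun i => (hP' i) ▸ hP'A (cls i)
  have hpp' : ∀ i, p i ≠ p' i := fun i => by rw [hP i, hP' i]; exact hPP' (cls i)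
  have hps : ∀ i k, p i ≠ s k := fun i k h => hsA k (h ▸ hpA i)
  have hp's : ∀ i k, p' i ≠ s k := fun i k h => hsA k (h ▸ hp'A i)
  have hPs : ∀ κ k, P κ ≠ s k := fun κ k h => hsA k (h ▸ hPA κ)
  have hcs : ∀ i, c ≠ s i := fun i h => hsA i (h ▸ hcA)
  -- weights
  set θ : Fin m → ℝ := fun i => (w s(s i, p i) : ℝ) * w s(s i, p' i) with hθ
  set uu : Fin (Mf + Mc) → ℝ := fun κ => ∏ i ∈ Finset.univ.filter (fun i => cls i = κ), (1 - θ i) with huu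
  set W : Finset (Fin (Mf + Mc)) → ℝ := fun S => (∏ κ ∈ S, (1 - uu κ)) * ∏ κ ∈ Finset.univ \ S, uu κ with hW
  set D : Fin Mc → ℝ := fun K => (1 - uu (Fin.natAdd Mf K)) *
    ∏ κ' ∈ Finset.univ.filter (fun κ' => ¬ (P κ' = P (Fin.natAdd Mf K) ∨ P κ' = P' (Fin.natAdd Mf K) ∨
      P' κ' = P (Fin.natAdd Mf K) ∨ P' κ' = P' (Fin.natAdd Mf K))), uu κ' with hD
  set cfF : Fin Mf → ℝ := fun I => (1 - uu (Fin.castAdd Mc I)) * ∏ K ∈ Finset.univ.filter (· < I), uu (Fin.castAdd Mc K) with hcfF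
  have hθ0 : ∀ i, 0 ≤ θ i := fun i => mul_nonneg (w _).2.1 (w _).2.1
  have hθ1 : ∀ i, θ i ≤ 1 := fun i => mul_le_one₀ (w _).2.2 (w _).2.1 (w _).2.2
  have huu0 : ∀ κ, 0 ≤ uu κ := fun κ => Finset.prod_nonneg fun i _ => sub_nonneg.2 (hθ1 i)
  have huu1 : ∀ κ, uu κ ≤ 1 := fun κ => Finset.prod_le_one (fun i _ => sub_nonneg.2 (hθ1 i)) fun i _ => sub_le_self _ (hθ0 i)
  have hDnn : ∀ K, 0 ≤ D K := fun K => mul_nonneg (sub_nonneg.2 (huu1 _)) (Finset.prod_nonneg fun κ' _ => huu0 κ')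
  have hcfFnn : ∀ I, 0 ≤ cfF I := fun I => mul_nonneg (sub_nonneg.2 (huu1 _)) (Finset.prod_nonneg fun K _ => huu0 _)
  -- the push-forward of star patterns to class patterns
  have hpush : ∀ F : Finset (Fin (Mf + Mc)) → ℝ,
      ∑ σ ∈ (Finset.univ : Finset (Fin m)).powerset, ((∏ i ∈ σ, θ i) * ∏ i ∈ Finset.univ \ σ, (1 - θ i)) * F (σ.image cls) =
        ∑ S ∈ (Finset.univ : Finset (Fin (Mf + Mc))).powerset, W S * F S := fun F => linkSum_pushforward θ cls F
  -- events
  set RK : Fin (Mf + Mc) → Finset (Fin n) := fun κ => ({κ} : Finset (Fin (Mf + Mc))).image P ∪ ({κ} : Finset (Fin (Mf + Mc))).image P'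
    with hRK
  set ρ : Fin Mc → Finset (Fin (Mf + Mc)) → Set (BondConfig (Fin n)) := fun K S => {ω' |
    (∀ u ∈ RK (Fin.natAdd Mf K), ¬ (openGraph ((ω' ∩ {e | ∀ v ∈ Finset.univ.image s, v ∉ e}) ∪
      ↑(S.image fun κ => (s(P κ, P' κ) : Sym2 (Fin n))))).Reachable c u) ∧
    (A.filter fun z => (openGraph ((ω' ∩ {e | ∀ v ∈ Finset.univ.image s, v ∉ e}) ∪
      ↑(S.image fun κ => (s(P κ, P' κ) : Sym2 (Fin n))))).Reachable c z).card ≤ j} with hρ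
  set ℓ : Fin Mc → Finset (Fin (Mf + Mc)) → Set (BondConfig (Fin n)) := fun K S => {ω' |
    (∀ u ∈ RK (Fin.natAdd Mf K), ¬ (openGraph ((ω' ∩ {e | ∀ v ∈ Finset.univ.image s, v ∉ e}) ∪
      ↑(S.image fun κ => (s(P κ, P' κ) : Sym2 (Fin n))))).Reachable c u) ∧
    1 ≤ (A.filter fun z => ∃ u ∈ RK (Fin.natAdd Mf K),
      (openGraph ((ω' ∩ {e | ∀ v ∈ Finset.univ.image s, v ∉ e}) ∪ ↑(S.image fun κ => (s(P κ, P' κ) : Sym2 (Fin n))))).Reachable u z).card ∧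
    (A.filter fun z => ∃ u ∈ RK (Fin.natAdd Mf K),
      (openGraph ((ω' ∩ {e | ∀ v ∈ Finset.univ.image s, v ∉ e}) ∪ ↑(S.image fun κ => (s(P κ, P' κ) : Sym2 (Fin n))))).Reachable u z).card ≤ j}
    with hℓ
  set D₁ : Finset (Fin (Mf + Mc)) → Set (BondConfig (Fin n)) := fun S => {ω' |
    (∀ u ∈ S.image P ∪ S.image P', ¬ (openGraph (ω' ∩ {e | ∀ v ∈ Finset.univ.image s, v ∉ e})).Reachable c u) ∧
      (A.filter fun z => (openGraph (ω' ∩ {e | ∀ v ∈ Finset.univ.image s, v ∉ e})).Reachable c z).card ≤ j} with hD₁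
  set D₂ : Finset (Fin (Mf + Mc)) → Set (BondConfig (Fin n)) := fun S => {ω' |
    (∀ u ∈ S.image P ∪ S.image P', ¬ (openGraph (ω' ∩ {e | ∀ v ∈ Finset.univ.image s, v ∉ e})).Reachable c u) ∧
      1 ≤ (A.filter fun z => ∃ u ∈ S.image P ∪ S.image P',
        (openGraph (ω' ∩ {e | ∀ v ∈ Finset.univ.image s, v ∉ e})).Reachable u z).card ∧
      (A.filter fun z => ∃ u ∈ S.image P ∪ S.image P',
        (openGraph (ω' ∩ {e | ∀ v ∈ Finset.univ.image s, v ∉ e})).Reachable u z).card ≤ j} with hD₂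
  set B : ι → Finset (Fin (Mf + Mc)) → Set (BondConfig (Fin n)) := fun t S => {ω' |
    (∀ u ∈ R t ∪ (S.image P ∪ S.image P'), ¬ (openGraph (ω' ∩ {e | ∀ v ∈ Finset.univ.image s, v ∉ e})).Reachable c u) ∧
      (A.filter fun z => (openGraph (ω' ∩ {e | ∀ v ∈ Finset.univ.image s, v ∉ e})).Reachable c z).card ≤ j} with hB
  set G : Finset (Fin (Mf + Mc)) → Set (BondConfig (Fin n)) := fun S => {ω' |
    (A.filter fun z => (openGraph ((ω' ∩ {e | ∀ v ∈ Finset.univ.image s, v ∉ e}) ∪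
      ↑(S.image fun κ => (s(P κ, P' κ) : Sym2 (Fin n))))).Reachable c z).card ≤ j} with hG
  set SpF : Fin Mf → Finset (Fin (Mf + Mc)) → Set (BondConfig (Fin n)) := fun I S => {ω' |
    (A.filter fun z => (openGraph ((ω' ∩ {e | ∀ v ∈ Finset.univ.image s, v ∉ e}) ∪
      ↑(S.image fun κ => (s(P κ, P' κ) : Sym2 (Fin n))))).Reachable (P (Fin.castAdd Mc I)) z).card ≤ j} with hSpF
  set PS : Finset (Finset (Fin (Mf + Mc))) := (Finset.univ : Finset (Fin (Mf + Mc))).powerset with hPS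
  change 0 ≤ C0 * ∑ S ∈ PS, W S * ((prodBernoulli w).real (D₁ S) - (prodBernoulli w).real (D₂ S)) +
    ∑ t, b t * ∑ S ∈ PS, W S * (prodBernoulli w).real (B t S)
  -- (1) the pointwise certificate
  have hpt : ∀ ω : BondConfig (Fin n),
      C0 * (∑ I, cfF I * ∑ S ∈ PS, W S * (DecisionTree.ind (G S) ω - DecisionTree.ind (SpF I S) ω) +
          ∑ K, D K * ∑ S ∈ PS, W S * (DecisionTree.ind (ρ K S) ω - DecisionTree.ind (ℓ K S) ω)) ≤
        C0 * ∑ S ∈ PS, W S * (DecisionTree.ind (D₁ S) ω - DecisionTree.ind (D₂ S) ω) +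
          ∑ t, b t * ∑ S ∈ PS, W S * DecisionTree.ind (B t S) ω :=
    fun ω => mixed_certificate_pointwise w A s p p' cls P P' c j hj hPA hP'A hPP' hnopar hforest hcA hcP C0 hC0 b hb R hRport hU0 hU1 ω
  -- (2) integrate
  have hwt0 : ∀ e : Sym2 (Fin n), 0 ≤ ((w e : unitInterval) : ℝ) := fun e => (w e).2.1
  have hwt1 : ∀ e : Sym2 (Fin n), ((w e : unitInterval) : ℝ) ≤ 1 := fun e => (w e).2.2
  have hupper : C0 * ∑ S ∈ PS, W S * ((prodBernoulli w).real (D₁ S) - (prodBernoulli w).real (D₂ S)) +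
      ∑ t, b t * ∑ S ∈ PS, W S * (prodBernoulli w).real (B t S) =
      ∑ ω : BondConfig (Fin n), BHK2006.weight (fun e => (w e : ℝ)) ω *
        (C0 * ∑ S ∈ PS, W S * (DecisionTree.ind (D₁ S) ω - DecisionTree.ind (D₂ S) ω) +
          ∑ t, b t * ∑ S ∈ PS, W S * DecisionTree.ind (B t S) ω) := by
    have e1 : C0 * ∑ S ∈ PS, W S * ((prodBernoulli w).real (D₁ S) - (prodBernoulli w).real (D₂ S)) =
        ∑ ω : BondConfig (Fin n), BHK2006.weight (fun e => (w e : ℝ)) ω *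
          (C0 * ∑ S ∈ PS, W S * (DecisionTree.ind (D₁ S) ω - DecisionTree.ind (D₂ S) ω)) := by
      rw [linkSum_real_sub_eq_sum w W D₁ D₂, Finset.mul_sum]
      exact Finset.sum_congr rfl fun ω _ => by ring
    have e2 : ∀ t, b t * ∑ S ∈ PS, W S * (prodBernoulli w).real (B t S) =
        ∑ ω : BondConfig (Fin n), BHK2006.weight (fun e => (w e : ℝ)) ω * (b t * ∑ S ∈ PS, W S * DecisionTree.ind (B t S) ω) := by
      intro t
      rw [linkSum_real_eq_sum w W (B t), Finset.mul_sum]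
      exact Finset.sum_congr rfl fun ω _ => by ring
    rw [e1, Finset.sum_congr rfl fun t _ => e2 t, Finset.sum_comm, ← Finset.sum_add_distrib]
    refine Finset.sum_congr rfl fun ω _ => ?_
    rw [← Finset.mul_sum, ← mul_add]
  have hlowC : ∑ K, D K * ∑ S ∈ PS, W S * ((prodBernoulli w).real (ρ K S) - (prodBernoulli w).real (ℓ K S)) =
      ∑ ω : BondConfig (Fin n), BHK2006.weight (fun e => (w e : ℝ)) ω *
        ∑ K, D K * ∑ S ∈ PS, W S * (DecisionTree.ind (ρ K S) ω - DecisionTree.ind (ℓ K S) ω) := by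
    have e3 : ∀ K, D K * ∑ S ∈ PS, W S * ((prodBernoulli w).real (ρ K S) - (prodBernoulli w).real (ℓ K S)) =
        ∑ ω : BondConfig (Fin n), BHK2006.weight (fun e => (w e : ℝ)) ω *
          (D K * ∑ S ∈ PS, W S * (DecisionTree.ind (ρ K S) ω - DecisionTree.ind (ℓ K S) ω)) := by
      intro K
      rw [linkSum_real_sub_eq_sum w W (ρ K) (ℓ K), Finset.mul_sum]
      exact Finset.sum_congr rfl fun ω _ => by ring
    rw [Finset.sum_congr rfl fun K _ => e3 K, Finset.sum_comm]
    refine Finset.sum_congr rfl fun ω _ => ?_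
    rw [Finset.mul_sum]
  have hlowF : ∑ I, cfF I * ∑ S ∈ PS, W S * ((prodBernoulli w).real (G S) - (prodBernoulli w).real (SpF I S)) =
      ∑ ω : BondConfig (Fin n), BHK2006.weight (fun e => (w e : ℝ)) ω *
        ∑ I, cfF I * ∑ S ∈ PS, W S * (DecisionTree.ind (G S) ω - DecisionTree.ind (SpF I S) ω) := by
    have e4 : ∀ I, cfF I * ∑ S ∈ PS, W S * ((prodBernoulli w).real (G S) - (prodBernoulli w).real (SpF I S)) =
        ∑ ω : BondConfig (Fin n), BHK2006.weight (fun e => (w e : ℝ)) ω *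
          (cfF I * ∑ S ∈ PS, W S * (DecisionTree.ind (G S) ω - DecisionTree.ind (SpF I S) ω)) := by
      intro I
      rw [linkSum_real_sub_eq_sum w W G (SpF I), Finset.mul_sum]
      exact Finset.sum_congr rfl fun ω _ => by ring
    rw [Finset.sum_congr rfl fun I _ => e4 I, Finset.sum_comm]
    refine Finset.sum_congr rfl fun ω _ => ?_
    rw [Finset.mul_sum]
  have hint : C0 * (∑ I, cfF I * ∑ S ∈ PS, W S * ((prodBernoulli w).real (G S) - (prodBernoulli w).real (SpF I S)) +
        ∑ K, D K * ∑ S ∈ PS, W S * ((prodBernoulli w).real (ρ K S) - (prodBernoulli w).real (ℓ K S))) ≤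
      C0 * ∑ S ∈ PS, W S * ((prodBernoulli w).real (D₁ S) - (prodBernoulli w).real (D₂ S)) +
        ∑ t, b t * ∑ S ∈ PS, W S * (prodBernoulli w).real (B t S) := by
    have e5 : C0 * (∑ I, cfF I * ∑ S ∈ PS, W S * ((prodBernoulli w).real (G S) - (prodBernoulli w).real (SpF I S)) +
        ∑ K, D K * ∑ S ∈ PS, W S * ((prodBernoulli w).real (ρ K S) - (prodBernoulli w).real (ℓ K S))) =
        ∑ ω : BondConfig (Fin n), BHK2006.weight (fun e => (w e : ℝ)) ω *
          (C0 * (∑ I, cfF I * ∑ S ∈ PS, W S * (DecisionTree.ind (G S) ω - DecisionTree.ind (SpF I S) ω) +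
            ∑ K, D K * ∑ S ∈ PS, W S * (DecisionTree.ind (ρ K S) ω - DecisionTree.ind (ℓ K S) ω))) := by
      rw [hlowF, hlowC, ← Finset.sum_add_distrib, Finset.mul_sum]
      exact Finset.sum_congr rfl fun ω _ => by ring
    rw [e5, hupper]
    exact Finset.sum_le_sum fun ω _ => mul_le_mul_of_nonneg_left (hpt ω) (BHK2006.weight_nonneg hwt0 hwt1 ω)
  -- (3) each pair row has nonnegative expectation (lonelier member `P K`, in the glued graphs)
  have hrowC : ∀ K, 0 ≤ ∑ S ∈ PS, W S * ((prodBernoulli w).real (ρ K S) - (prodBernoulli w).real (ℓ K S)) := by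
    intro K
    have hRs : ∀ u ∈ RK (Fin.natAdd Mf K), ∀ i, u ≠ s i := by
      intro u hu i
      simp only [hRK, Finset.image_singleton, Finset.mem_union, Finset.mem_singleton] at hu
      rcases hu with rfl | rfl
      · exact fun h => hsA i (h ▸ hPA _)
      · exact fun h => hsA i (h ▸ hP'A _)
    have hy : P (Fin.natAdd Mf K) ∈ RK (Fin.natAdd Mf K) := by simp [hRK]
    have h := linkRow_le w A s p p' (RK (Fin.natAdd Mf K)) (P (Fin.natAdd Mf K)) c j hs hps hp's hpp' hwjunk hsA hRs hcs hy (hdom _)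
    have hℓσ : ∀ σ : Finset (Fin m), (prodBernoulli w).real (ℓ K (σ.image cls)) =
        (prodBernoulli w).real {ω : BondConfig (Fin n) |
          (∀ u ∈ RK (Fin.natAdd Mf K), ¬ (openGraph ((ω ∩ {e | ∀ v ∈ Finset.univ.image s, v ∉ e}) ∪
            ↑(σ.image fun i => (s(p i, p' i) : Sym2 (Fin n))))).Reachable c u) ∧
          1 ≤ (A.filter fun z => ∃ u ∈ RK (Fin.natAdd Mf K), (openGraph ((ω ∩ {e | ∀ v ∈ Finset.univ.image s, v ∉ e}) ∪
            ↑(σ.image fun i => (s(p i, p' i) : Sym2 (Fin n))))).Reachable u z).card ∧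
          (A.filter fun z => ∃ u ∈ RK (Fin.natAdd Mf K), (openGraph ((ω ∩ {e | ∀ v ∈ Finset.univ.image s, v ∉ e}) ∪
            ↑(σ.image fun i => (s(p i, p' i) : Sym2 (Fin n))))).Reachable u z).card ≤ j} := by
      intro σ; simp only [hℓ]; rw [linkPattern_eq_classPattern p p' cls P P' hP hP' σ]
    have hρσ : ∀ σ : Finset (Fin m), (prodBernoulli w).real (ρ K (σ.image cls)) =
        (prodBernoulli w).real {ω : BondConfig (Fin n) |
          (∀ u ∈ RK (Fin.natAdd Mf K), ¬ (openGraph ((ω ∩ {e | ∀ v ∈ Finset.univ.image s, v ∉ e}) ∪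
            ↑(σ.image fun i => (s(p i, p' i) : Sym2 (Fin n))))).Reachable c u) ∧
          (A.filter fun z => (openGraph ((ω ∩ {e | ∀ v ∈ Finset.univ.image s, v ∉ e}) ∪
            ↑(σ.image fun i => (s(p i, p' i) : Sym2 (Fin n))))).Reachable c z).card ≤ j} := by
      intro σ; simp only [hρ]; rw [linkPattern_eq_classPattern p p' cls P P' hP hP' σ]
    have hL : ∑ S ∈ PS, W S * (prodBernoulli w).real (ℓ K S) =
        ∑ σ ∈ (Finset.univ : Finset (Fin m)).powerset, ((∏ i ∈ σ, θ i) * ∏ i ∈ Finset.univ \ σ, (1 - θ i)) *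
          (prodBernoulli w).real (ℓ K (σ.image cls)) := (hpush (fun S => (prodBernoulli w).real (ℓ K S))).symm
    have hR : ∑ S ∈ PS, W S * (prodBernoulli w).real (ρ K S) =
        ∑ σ ∈ (Finset.univ : Finset (Fin m)).powerset, ((∏ i ∈ σ, θ i) * ∏ i ∈ Finset.univ \ σ, (1 - θ i)) *
          (prodBernoulli w).real (ρ K (σ.image cls)) := (hpush (fun S => (prodBernoulli w).real (ρ K S))).symm
    have hsplit : ∑ S ∈ PS, W S * ((prodBernoulli w).real (ρ K S) - (prodBernoulli w).real (ℓ K S)) =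
        ∑ S ∈ PS, W S * (prodBernoulli w).real (ρ K S) - ∑ S ∈ PS, W S * (prodBernoulli w).real (ℓ K S) := by
      rw [← Finset.sum_sub_distrib]; exact Finset.sum_congr rfl fun S _ => by ring
    have hL' := hL.trans (Finset.sum_congr rfl fun σ _ => by rw [hℓσ σ])
    have hR' := hR.trans (Finset.sum_congr rfl fun σ _ => by rw [hρσ σ])
    rw [hsplit, hL', hR']
    exact sub_nonneg.2 h
  -- (4) each champion row has nonnegative expectation: `I_w(c) − I_w(P_I) ≥ 0`
  have hGσ : ∀ σ : Finset (Fin m), (prodBernoulli w).real (G (σ.image cls)) =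
      (prodBernoulli w).real {ω : BondConfig (Fin n) |
        (A.filter fun z => (openGraph ((ω ∩ {e | ∀ v ∈ Finset.univ.image s, v ∉ e}) ∪
          ↑(σ.image fun i => (s(p i, p' i) : Sym2 (Fin n))))).Reachable c z).card ≤ j} := by
    intro σ
    simp only [hG, linkPattern_eq_classPattern p p' cls P P' hP hP' σ]
  have hSpσ : ∀ (I : Fin Mf) (σ : Finset (Fin m)), (prodBernoulli w).real (SpF I (σ.image cls)) =
      (prodBernoulli w).real {ω : BondConfig (Fin n) |
        (A.filter fun z => (openGraph ((ω ∩ {e | ∀ v ∈ Finset.univ.image s, v ∉ e}) ∪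
          ↑(σ.image fun i => (s(p i, p' i) : Sym2 (Fin n))))).Reachable (P (Fin.castAdd Mc I)) z).card ≤ j} := by
    intro I σ
    simp only [hSpF, linkPattern_eq_classPattern p p' cls P P' hP hP' σ]
  have hIc : (prodBernoulli w).real {ω : BondConfig (Fin n) | (A.filter fun z => ω ∈ openConn c z).card ≤ j} =
      ∑ S ∈ PS, W S * (prodBernoulli w).real (G S) := by
    have h := lightness_eq_linkSum w A s p p' c j hs hps hp's hpp' hwjunk hsA hcs
    rw [← hpush (fun S => (prodBernoulli w).real (G S))]
    have h2 : ∑ σ ∈ (Finset.univ : Finset (Fin m)).powerset, ((∏ i ∈ σ, θ i) * ∏ i ∈ Finset.univ \ σ, (1 - θ i)) *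
        (fun S => (prodBernoulli w).real (G S)) (σ.image cls) =
      ∑ σ ∈ (Finset.univ : Finset (Fin m)).powerset, ((∏ i ∈ σ, θ i) * ∏ i ∈ Finset.univ \ σ, (1 - θ i)) *
        (prodBernoulli w).real {ω : BondConfig (Fin n) |
          (A.filter fun z => (openGraph ((ω ∩ {e | ∀ v ∈ Finset.univ.image s, v ∉ e}) ∪
            ↑(σ.image fun i => (s(p i, p' i) : Sym2 (Fin n))))).Reachable c z).card ≤ j} := by
      refine Finset.sum_congr rfl fun σ _ => ?_
      simp only [hGσ σ]
    rw [h2]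
    convert h using 12
    exact Iff.rfl
  have hIp : ∀ I : Fin Mf, (prodBernoulli w).real {ω : BondConfig (Fin n) |
        (A.filter fun z => ω ∈ openConn (P (Fin.castAdd Mc I)) z).card ≤ j} =
      ∑ S ∈ PS, W S * (prodBernoulli w).real (SpF I S) := by
    intro I
    have h := lightness_eq_linkSum w A s p p' (P (Fin.castAdd Mc I)) j hs hps hp's hpp' hwjunk hsA (fun k => hPs _ k)
    rw [← hpush (fun S => (prodBernoulli w).real (SpF I S))]
    have h2 : ∑ σ ∈ (Finset.univ : Finset (Fin m)).powerset, ((∏ i ∈ σ, θ i) * ∏ i ∈ Finset.univ \ σ, (1 - θ i)) *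
        (fun S => (prodBernoulli w).real (SpF I S)) (σ.image cls) =
      ∑ σ ∈ (Finset.univ : Finset (Fin m)).powerset, ((∏ i ∈ σ, θ i) * ∏ i ∈ Finset.univ \ σ, (1 - θ i)) *
        (prodBernoulli w).real {ω : BondConfig (Fin n) |
          (A.filter fun z => (openGraph ((ω ∩ {e | ∀ v ∈ Finset.univ.image s, v ∉ e}) ∪
            ↑(σ.image fun i => (s(p i, p' i) : Sym2 (Fin n))))).Reachable (P (Fin.castAdd Mc I)) z).card ≤ j} := by
      refine Finset.sum_congr rfl fun σ _ => ?_
      simp only [hSpσ I σ]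
    rw [h2]
    convert h using 12
    exact Iff.rfl
  have hrowF : ∀ I : Fin Mf, 0 ≤ ∑ S ∈ PS, W S * ((prodBernoulli w).real (G S) - (prodBernoulli w).real (SpF I S)) := by
    intro I
    have heq : ∑ S ∈ PS, W S * ((prodBernoulli w).real (G S) - (prodBernoulli w).real (SpF I S)) =
        (prodBernoulli w).real {ω : BondConfig (Fin n) | (A.filter fun z => ω ∈ openConn c z).card ≤ j} -
          (prodBernoulli w).real {ω : BondConfig (Fin n) | (A.filter fun z => ω ∈ openConn (P (Fin.castAdd Mc I)) z).card ≤ j} := by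
      rw [hIc, hIp I, ← Finset.sum_sub_distrib]
      refine Finset.sum_congr rfl fun S _ => ?_
      ring
    rw [heq]
    exact sub_nonneg.2 (hdom _)
  have hlb : 0 ≤ C0 * (∑ I, cfF I * ∑ S ∈ PS, W S * ((prodBernoulli w).real (G S) - (prodBernoulli w).real (SpF I S)) +
      ∑ K, D K * ∑ S ∈ PS, W S * ((prodBernoulli w).real (ρ K S) - (prodBernoulli w).real (ℓ K S))) :=
    mul_nonneg hC0 (add_nonneg (Finset.sum_nonneg fun I _ => mul_nonneg (hcfFnn I) (hrowF I))
      (Finset.sum_nonneg fun K _ => mul_nonneg (hDnn K) (hrowC K)))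
  exact le_trans hlb hint

end StarSet

end Summit.CriticalPhenomena.PercolationContinuityZ3.Theorems

end
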